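import Summits.HubbardSuperconductivity.HubbardSuperconductivity.Theses.CooperPairDMottWalk
import Literature.MathematicalPhysics.QuantumLattice.PlaquetteBreathingSelfDuality
import Literature.MathematicalPhysics.QuantumLattice.FreeFermiGasNoPairFieldLRO
import Literature.MathematicalPhysics.QuantumLattice.MagneticHubbardTorusGauge
import Literature.MathematicalPhysics.QuantumLattice.HubbardModelParticleHoleProofs

/-!
# Route `CooperPairDMottWalk`, crux `BindingWalk` (stmt-HubbardSuperconductivity-1176):
# transport of the Cooper-pair package along the self-duality of the breathing family

Helper file (`--supports stmt-HubbardSuperconductivity-1176`) for the registered line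
`Cruxes/BindingWalk/Lines/birth.lean`. The crux walks the route's Cooper-pair package
`CP L H ε z` — (a) two-hole pair binding with margin `ε`, (b) uniqueness of the `(L²-2, S^z=0)`
sector ground state, (c) `d_{x²-y²}` pair amplitude `≥ z L²` against the half-filled ground state —
along the breathing family `H_L(a,b,U) = hamiltonian(intra) a U + hamiltonian(inter) b 0`, whose
proved support `BreathingSelfDualFourLe` (`breathingSelfDual_of_four_le`: a unitary `W` with
`W H_L(a,b,U) W* = H_L(b,a,U)` fixing `N`, `S^z` and the `d`-wave pair field, even `L ≥ 4`) is
only usable once the PACKAGE is known to be invariant under such a `W`. This file proves that: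

* `minEnergyOn_szSector_unitary_conj`, `isGroundStateInSector_unitary_conj_iff` — sector energies
  and sector ground states under a unitary fixing `N` and `S^z`;
* `cooperPackage_unitary_conj_iff` — the whole package (a)∧(b)∧(c) is invariant under a unitary
  fixing `N`, `S^z` and `pairField dWaveFormFactor L` (the package is written out verbatim, the
  route's `let CP`);
* `cooperPackage_breathing_swap` — hence `CP L (H_L(a,b,U)) ε z ↔ CP L (H_L(b,a,U)) ε z` for even
  `L ≥ 4`: the walk's data are symmetric under `a ↔ b`, and the pure point `a = b = 1` is the
  fixed point of this symmetry;
* `minEnergyOn_real_smul`, `isGroundStateInSector_real_smul_iff`, `cooperPackage_smul_iff`,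
  `breathing_scale` — positive rescaling: `H_L(a,b,U) = a · H_L(1, b/a, U/a)` and
  `CP L (c • H) (c ε) z ↔ CP L H ε z` (`c > 0`);
* `corner_transport` — consequently the crux's corner hypothesis at `(1, b, U₀)` yields the
  package at the OPPOSITE corner `(1, 1/b, U₀/b)` with margin `ε/b` (large inter-plaquette
  hopping, `U/t_inter = U₀` fixed): the only motion along the family that the symmetry alone
  provides — it never reaches the self-dual point, which is why `stub_junctionLeg` is genuine.

References: H. Yao, W.-F. Tsai, S. A. Kivelson, PRB 76 (2007) 161104 (checkerboard Hubbard model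
and its plaquette phases); H. Tasaki, *Physics and Mathematics of Quantum Many-Body Systems*
(2020) §2.2 (variational characterisation of sector energies). All statements are elementary
linear algebra over tree definitions; no definition and no named fact is introduced.
-/

set_option linter.dupNamespace false

noncomputable section

namespace Summit.HubbardSuperconductivity.HubbardSuperconductivity.Theorems.CooperPairDMottWalk

open Matrix Finset Literature.MathematicalPhysics.QuantumLattice
open scoped ComplexOrder Pointwise

/-! ### Unitaries fixing `N` and `S^z`: sector energies and sector ground states

The unitarity of `W` is taken in the instance-free form `W*(W v) = v`, `W(W* v) = v` (on the
fermionic torus the `DecidableEq` instance behind `1 : Matrix` and `Matrix.unitaryGroup` is not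
canonical, cf. `mem_unitaryGroup_of_mem_unitaryGroup` in `PlaquetteBreathingSelfDuality`). -/

section Unitary

variable {Λ : Type*} [LinearOrder Λ] [Fintype Λ]

omit [LinearOrder Λ] in
/-- `W A W* = A` and `W*(W v) = v` give `W A = A W`. [folklore] -/
theorem commute_of_unitary_conj_eq {W A : Matrix (Finset (Orb Λ)) (Finset (Orb Λ)) ℂ}
    (hWl : ∀ v : Fock (Orb Λ), star W *ᵥ (W *ᵥ v) = v) (h : W * A * star W = A) : Commute W A := by
  refine matrix_eq_of_mulVec_eq fun ψ => ?_
  have h' := congrArg (fun X => X *ᵥ (W *ᵥ ψ)) h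
  simp only [← mulVec_mulVec, hWl] at h'
  rw [← mulVec_mulVec, ← mulVec_mulVec, h']

omit [LinearOrder Λ] in
/-- `W A W* = A` and `W*(W v) = v` give `W* A = A W*`. [folklore] -/
theorem commute_star_of_unitary_conj_eq {W A : Matrix (Finset (Orb Λ)) (Finset (Orb Λ)) ℂ}
    (hWl : ∀ v : Fock (Orb Λ), star W *ᵥ (W *ᵥ v) = v) (h : W * A * star W = A) :
    Commute (star W) A := by
  refine matrix_eq_of_mulVec_eq fun ψ => ?_
  have h' := congrArg (fun X => star W *ᵥ (X *ᵥ ψ)) h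
  simp only [← mulVec_mulVec, hWl] at h'
  rw [← mulVec_mulVec, ← mulVec_mulVec, h']

/-- A unitary fixing `N` and `S^z` maps every joint sector into itself, and so does its adjoint.
[folklore] -/
theorem unitary_mulVec_mem_szSector {W : Matrix (Finset (Orb Λ)) (Finset (Orb Λ)) ℂ}
    (hWl : ∀ v : Fock (Orb Λ), star W *ᵥ (W *ᵥ v) = v) (hN : W * totalNumber * star W = totalNumber)
    (hS : W * HubbardWave0.spinZ * star W = HubbardWave0.spinZ) {N : ℕ} {M : ℝ} {v : Fock (Orb Λ)}
    (hv : v ∈ szSector N M) : W *ᵥ v ∈ szSector N M ∧ star W *ᵥ v ∈ szSector N M :=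
  ⟨mulVec_mem_szSector_of_commute (commute_of_unitary_conj_eq hWl hN) (commute_of_unitary_conj_eq hWl hS) hv,
    mulVec_mem_szSector_of_commute (commute_star_of_unitary_conj_eq hWl hN)
      (commute_star_of_unitary_conj_eq hWl hS) hv⟩

/-- **Sector energies are invariant under a unitary fixing `N` and `S^z`**:
`minEnergyOn (W H W*) (szSector N M) = minEnergyOn H (szSector N M)`. Tasaki (2020) §2.2. [folklore] -/
theorem minEnergyOn_szSector_unitary_conj {W : Matrix (Finset (Orb Λ)) (Finset (Orb Λ)) ℂ}
    (hWl : ∀ v : Fock (Orb Λ), star W *ᵥ (W *ᵥ v) = v) (hWr : ∀ v : Fock (Orb Λ), W *ᵥ (star W *ᵥ v) = v)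
    (hN : W * totalNumber * star W = totalNumber) (hS : W * HubbardWave0.spinZ * star W = HubbardWave0.spinZ)
    (H : Matrix (Finset (Orb Λ)) (Finset (Orb Λ)) ℂ) (N : ℕ) (M : ℝ) :
    (W * H * star W).minEnergyOn (szSector N M) = H.minEnergyOn (szSector N M) := by
  have hW1 : Wᴴ * W = 1 := matrix_eq_of_mulVec_eq fun ψ => by
    rw [← mulVec_mulVec, ← star_eq_conjTranspose, hWl, one_mulVec]
  have hW2 : W * Wᴴ = 1 := matrix_eq_of_mulVec_eq fun ψ => by
    rw [← mulVec_mulVec, ← star_eq_conjTranspose, hWr, one_mulVec]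
  have key := Matrix.minEnergyOn_conjTranspose_mul_mul (W * H * star W) W (szSector N M) hW1 hW2
    (fun ψ hψ => (unitary_mulVec_mem_szSector hWl hN hS hψ).1)
    (fun ψ hψ => by rw [← star_eq_conjTranspose]; exact (unitary_mulVec_mem_szSector hWl hN hS hψ).2)
  rw [← key]
  congr 1
  refine matrix_eq_of_mulVec_eq fun ψ => ?_
  rw [← star_eq_conjTranspose]
  simp only [← mulVec_mulVec, hWl]

/-- **Sector ground states under a unitary fixing `N` and `S^z`**: `φ` is a ground state of
`W H W*` in the sector `(N, M)` iff `W* φ` is one of `H`. Tasaki (2020) §2.2. [folklore] -/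
theorem isGroundStateInSector_unitary_conj_iff {W : Matrix (Finset (Orb Λ)) (Finset (Orb Λ)) ℂ}
    (hWl : ∀ v : Fock (Orb Λ), star W *ᵥ (W *ᵥ v) = v) (hWr : ∀ v : Fock (Orb Λ), W *ᵥ (star W *ᵥ v) = v)
    (hN : W * totalNumber * star W = totalNumber) (hS : W * HubbardWave0.spinZ * star W = HubbardWave0.spinZ)
    (H : Matrix (Finset (Orb Λ)) (Finset (Orb Λ)) ℂ) (N : ℕ) (M : ℝ) (φ : Fock (Orb Λ)) :
    IsGroundStateInSector (W * H * star W) N M φ ↔ IsGroundStateInSector H N M (star W *ᵥ φ) := by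
  unfold IsGroundStateInSector
  rw [minEnergyOn_szSector_unitary_conj hWl hWr hN hS]
  constructor
  · rintro ⟨hmem, hne, heig⟩
    refine ⟨(unitary_mulVec_mem_szSector hWl hN hS hmem).2, ?_, ?_⟩
    · intro h0
      exact hne (by rw [← hWr φ, h0, mulVec_zero])
    · have h := congrArg (star W *ᵥ ·) heig
      simp only [← mulVec_mulVec, mulVec_smul, hWl] at h
      exact h
  · rintro ⟨hmem, hne, heig⟩
    refine ⟨?_, ?_, ?_⟩
    · have h := (unitary_mulVec_mem_szSector hWl hN hS hmem).1
      rwa [hWr] at h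
    · intro h0
      exact hne (by rw [h0, mulVec_zero])
    · have h := congrArg (W *ᵥ ·) heig
      simp only [mulVec_smul, hWr] at h
      simp only [← mulVec_mulVec]
      exact h

omit [LinearOrder Λ] in
/-- Overlaps with an operator fixed by the unitary: `⟨W* φ₂, Δ (W* φ₀)⟩ = ⟨φ₂, Δ φ₀⟩` when
`W Δ W* = Δ`. [folklore] -/
theorem star_mulVec_dotProduct_fixed {W Δ : Matrix (Finset (Orb Λ)) (Finset (Orb Λ)) ℂ}
    (hΔ : W * Δ * star W = Δ) (φ₂ φ₀ : Fock (Orb Λ)) :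
    star (star W *ᵥ φ₂) ⬝ᵥ Δ *ᵥ (star W *ᵥ φ₀) = star φ₂ ⬝ᵥ Δ *ᵥ φ₀ := by
  simp only [star_eq_conjTranspose] at hΔ ⊢
  rw [star_mulVec, conjTranspose_conjTranspose, ← dotProduct_mulVec, mulVec_mulVec, mulVec_mulVec, hΔ]

omit [LinearOrder Λ] in
/-- Norms under the adjoint of a unitary: `⟨W* φ, W* φ⟩ = ⟨φ, φ⟩`. [folklore] -/
theorem star_mulVec_dotProduct_self_unitary_star {W : Matrix (Finset (Orb Λ)) (Finset (Orb Λ)) ℂ}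
    (hWr : ∀ v : Fock (Orb Λ), W *ᵥ (star W *ᵥ v) = v) (φ : Fock (Orb Λ)) :
    star (star W *ᵥ φ) ⬝ᵥ (star W *ᵥ φ) = star φ ⬝ᵥ φ := by
  refine Matrix.star_mulVec_dotProduct_self_of_unitary (V := star W) (fun v => ?_) φ
  rw [← star_eq_conjTranspose, star_star, hWr]

end Unitary

/-! ### The Cooper-pair package under a unitary fixing `N`, `S^z` and the `d`-wave pair field -/

section Package

/-- **The route's Cooper-pair package is invariant under a unitary fixing `N`, `S^z` and the
`d`-wave pair field.** For `W` unitary with `W N W* = N`, `W S^z W* = S^z`, `W Δ_d W* = Δ_d`: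
the package (a)∧(b)∧(c) (the route's `let CP`, written out) holds for `W H W*` iff it holds for
`H`, with the same `ε`, `z`. Tasaki (2020) §2.2. [folklore] -/
theorem cooperPackage_unitary_conj_iff :
    ∀ {L : ℕ} [NeZero L] {W H : Matrix (Finset (Orb (FermionTorus 2 L))) (Finset (Orb (FermionTorus 2 L))) ℂ}, W ∈ Matrix.unitaryGroup (Finset (Orb (FermionTorus 2 L))) ℂ → W * totalNumber * star W = totalNumber → W * HubbardWave0.spinZ * star W = HubbardWave0.spinZ → W * pairField dWaveFormFactor L * star W = pairField dWaveFormFactor L → ∀ (ε z : ℝ), ((W * H * star W).minEnergyOn (szSector (L ^ 2 - 2) 0) + (W * H * star W).minEnergyOn (szSector (L ^ 2) 0) + ε ≤ 2 * (W * H * star W).minEnergyOn (szSector (L ^ 2 - 1) (1 / 2)) ∧ (∀ φ₁ φ₂, IsGroundStateInSector (W * H * star W) (L ^ 2 - 2) 0 φ₁ → IsGroundStateInSector (W * H * star W) (L ^ 2 - 2) 0 φ₂ → ∃ c : ℂ, φ₂ = c • φ₁) ∧ (∀ φ₀ φ₂, IsGroundStateInSector (W * H * star W) (L ^ 2) 0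 φ₀ → IsGroundStateInSector (W * H * star W) (L ^ 2 - 2) 0 φ₂ → z * (L : ℝ) ^ 2 * (star φ₀ ⬝ᵥ φ₀).re * (star φ₂ ⬝ᵥ φ₂).re ≤ ‖star φ₂ ⬝ᵥ (pairField dWaveFormFactor L *ᵥ φ₀)‖ ^ 2)) ↔ (H.minEnergyOn (szSector (L ^ 2 - 2) 0) + H.minEnergyOn (szSector (L ^ 2) 0) + ε ≤ 2 * H.minEnergyOn (szSector (L ^ 2 - 1) (1 / 2)) ∧ (∀ φ₁ φ₂, IsGroundStateInSector H (L ^ 2 - 2) 0 φ₁ → IsGroundStateInSector H (L ^ 2 - 2) 0 φ₂ → ∃ c : ℂ, φ₂ = c • φ₁) ∧ (∀ φ₀ φ₂, IsGroundStateInSector H (L ^ 2) 0 φ₀ → IsGroundStateInSector H (L ^ 2 - 2) 0 φ₂ → z * (L : ℝ) ^ 2 * (star φ₀ ⬝ᵥ φ₀).re * (star φ₂ ⬝ᵥ φ₂).re ≤ ‖star φ₂ ⬝ᵥ (pairField dWaveFormFactor L *ᵥ φ₀)‖ ^ 2)) := by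
  intro L _ W H hW hN hS hΔ ε z
  have hWl : ∀ v : Fock (Orb (FermionTorus 2 L)), star W *ᵥ (W *ᵥ v) = v := fun v => by
    rw [mulVec_mulVec, Matrix.mem_unitaryGroup_iff'.1 hW, one_mulVec]
  have hWr : ∀ v : Fock (Orb (FermionTorus 2 L)), W *ᵥ (star W *ᵥ v) = v := fun v => by
    rw [mulVec_mulVec, Matrix.mem_unitaryGroup_iff.1 hW, one_mulVec]
  -- norms and overlaps along `ψ ↦ W ψ` and `φ ↦ W* φ`
  have hnW : ∀ ψ : Fock (Orb (FermionTorus 2 L)), star (W *ᵥ ψ) ⬝ᵥ (W *ᵥ ψ) = star ψ ⬝ᵥ ψ :=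
    fun ψ => Matrix.star_mulVec_dotProduct_self_of_unitary (V := W)
      (fun v => by rw [← star_eq_conjTranspose, hWl]) ψ
  have hnS : ∀ φ : Fock (Orb (FermionTorus 2 L)), star (star W *ᵥ φ) ⬝ᵥ (star W *ᵥ φ) = star φ ⬝ᵥ φ :=
    star_mulVec_dotProduct_self_unitary_star hWr
  have hΔ' : star W * pairField dWaveFormFactor L * star (star W) = pairField dWaveFormFactor L := by
    rw [star_star]
    refine matrix_eq_of_mulVec_eq fun ψ => ?_
    have h := congrArg (fun X => star W *ᵥ (X *ᵥ (W *ᵥ ψ))) hΔ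
    simp only [← mulVec_mulVec, hWl] at h
    simp only [← mulVec_mulVec]
    exact h.symm
  have hoW : ∀ ψ₂ ψ₀ : Fock (Orb (FermionTorus 2 L)),
      star (W *ᵥ ψ₂) ⬝ᵥ pairField dWaveFormFactor L *ᵥ (W *ᵥ ψ₀) =
        star ψ₂ ⬝ᵥ pairField dWaveFormFactor L *ᵥ ψ₀ := fun ψ₂ ψ₀ => by
    have h := star_mulVec_dotProduct_fixed hΔ' ψ₂ ψ₀
    rwa [star_star] at h
  have hoS : ∀ φ₂ φ₀ : Fock (Orb (FermionTorus 2 L)),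
      star (star W *ᵥ φ₂) ⬝ᵥ pairField dWaveFormFactor L *ᵥ (star W *ᵥ φ₀) =
        star φ₂ ⬝ᵥ pairField dWaveFormFactor L *ᵥ φ₀ := star_mulVec_dotProduct_fixed hΔ
  simp only [minEnergyOn_szSector_unitary_conj hWl hWr hN hS H,
    isGroundStateInSector_unitary_conj_iff hWl hWr hN hS H]
  refine and_congr Iff.rfl (and_congr ⟨fun h ψ₁ ψ₂ h₁ h₂ => ?_, fun h φ₁ φ₂ h₁ h₂ => ?_⟩
    ⟨fun h ψ₀ ψ₂ h₀ h₂ => ?_, fun h φ₀ φ₂ h₀ h₂ => ?_⟩)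
  · obtain ⟨c, hc⟩ := h (W *ᵥ ψ₁) (W *ᵥ ψ₂) (by rwa [hWl]) (by rwa [hWl])
    refine ⟨c, ?_⟩
    have h' := congrArg (star W *ᵥ ·) hc
    simpa only [hWl, mulVec_smul] using h'
  · obtain ⟨c, hc⟩ := h _ _ h₁ h₂
    refine ⟨c, ?_⟩
    have h' := congrArg (W *ᵥ ·) hc
    simpa only [hWr, mulVec_smul] using h'
  · have h' := h (W *ᵥ ψ₀) (W *ᵥ ψ₂) (by rwa [hWl]) (by rwa [hWl])
    rwa [hnW, hnW, hoW] at h'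
  · have h' := h _ _ h₀ h₂
    rwa [hnS, hnS, hoS] at h'

end Package

section Swap

/-- **Self-duality of the walk's data.** On the torus of even side `L ≥ 4` the Cooper-pair
package of the breathing Hamiltonian `H_L(a,b,U) = hamiltonian(intra) a U + hamiltonian(inter) b 0`
holds iff it holds for `H_L(b,a,U)`, with the same `ε`, `z` (transport along the diagonal
translation of `breathingSelfDual_of_four_le`, which swaps intra- and inter-plaquette bonds and
fixes `N`, `S^z`, `Δ_d`). The pure model `a = b = 1` is the fixed point.
[cite: YaoTsaiKivelson2007] -/
theorem cooperPackage_breathing_swap :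
    ∀ {L : ℕ} [NeZero L], Even L → 4 ≤ L → ∀ (a b U ε z : ℝ), ((hamiltonian (fermionTorusGraph 2 L \ (⊤ : SimpleGraph (Fin 2 → ℕ)).comap (fun (x : FermionTorus 2 L) (i : Fin 2) => (ofLex x i : ℕ) / 2)) a U + hamiltonian (fermionTorusGraph 2 L ⊓ (⊤ : SimpleGraph (Fin 2 → ℕ)).comap (fun (x : FermionTorus 2 L) (i : Fin 2) => (ofLex x i : ℕ) / 2)) b 0).minEnergyOn (szSector (L ^ 2 - 2) 0) + (hamiltonian (fermionTorusGraph 2 L \ (⊤ : SimpleGraph (Fin 2 → ℕ)).comap (fun (x : FermionTorus 2 L) (i : Fin 2) => (ofLex x i : ℕ) / 2)) a U + hamiltonian (fermionTorusGraph 2 L ⊓ (⊤ : SimpleGraph (Fin 2 → ℕ)).comap (fun (x : FermionTorus 2 L) (i : Fin 2) => (ofLex x i : ℕ) / 2)) b 0).minEnergyOn (szSector (L ^ 2) 0) + ε ≤ 2 * (hamiltonian (fermionTorusGraph 2 L \ (⊤ : SimpleGraph (Fin 2 → ℕ)).comap (fun (x : FermionTorus 2 L) (i : Fin 2) => (ofLex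 x i : ℕ) / 2)) a U + hamiltonian (fermionTorusGraph 2 L ⊓ (⊤ : SimpleGraph (Fin 2 → ℕ)).comap (fun (x : FermionTorus 2 L) (i : Fin 2) => (ofLex x i : ℕ) / 2)) b 0).minEnergyOn (szSector (L ^ 2 - 1) (1 / 2)) ∧ (∀ φ₁ φ₂, IsGroundStateInSector (hamiltonian (fermionTorusGraph 2 L \ (⊤ : SimpleGraph (Fin 2 → ℕ)).comap (fun (x : FermionTorus 2 L) (i : Fin 2) => (ofLex x i : ℕ) / 2)) a U + hamiltonian (fermionTorusGraph 2 L ⊓ (⊤ : SimpleGraph (Fin 2 → ℕ)).comap (fun (x : FermionTorus 2 L) (i : Fin 2) => (ofLex x i : ℕ) / 2)) b 0) (L ^ 2 - 2) 0 φ₁ → IsGroundStateInSector (hamiltonian (fermionTorusGraph 2 L \ (⊤ : SimpleGraph (Fin 2 → ℕ)).comap (fun (x : FermionTorus 2 L) (i : Fin 2) => (ofLex x i : ℕ) / 2)) a U + hamiltonian (fermionTorusGraph 2 L ⊓ (⊤ : SimpleGraph (Fin 2 → ℕ)).comap (fun (x : FermionTorus 2 L) (i : Fin 2) => (ofLex x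 i : ℕ) / 2)) b 0) (L ^ 2 - 2) 0 φ₂ → ∃ c : ℂ, φ₂ = c • φ₁) ∧ (∀ φ₀ φ₂, IsGroundStateInSector (hamiltonian (fermionTorusGraph 2 L \ (⊤ : SimpleGraph (Fin 2 → ℕ)).comap (fun (x : FermionTorus 2 L) (i : Fin 2) => (ofLex x i : ℕ) / 2)) a U + hamiltonian (fermionTorusGraph 2 L ⊓ (⊤ : SimpleGraph (Fin 2 → ℕ)).comap (fun (x : FermionTorus 2 L) (i : Fin 2) => (ofLex x i : ℕ) / 2)) b 0) (L ^ 2) 0 φ₀ → IsGroundStateInSector (hamiltonian (fermionTorusGraph 2 L \ (⊤ : SimpleGraph (Fin 2 → ℕ)).comap (fun (x : FermionTorus 2 L) (i : Fin 2) => (ofLex x i : ℕ) / 2)) a U + hamiltonian (fermionTorusGraph 2 L ⊓ (⊤ : SimpleGraph (Fin 2 → ℕ)).comap (fun (x : FermionTorus 2 L) (i : Fin 2) => (ofLex x i : ℕ) / 2)) b 0) (L ^ 2 - 2) 0 φ₂ → z * (L : ℝ) ^ 2 * (star φ₀ ⬝ᵥ φ₀).re * (star φ₂ ⬝ᵥ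 φ₂).re ≤ ‖star φ₂ ⬝ᵥ (pairField dWaveFormFactor L *ᵥ φ₀)‖ ^ 2)) ↔ ((hamiltonian (fermionTorusGraph 2 L \ (⊤ : SimpleGraph (Fin 2 → ℕ)).comap (fun (x : FermionTorus 2 L) (i : Fin 2) => (ofLex x i : ℕ) / 2)) b U + hamiltonian (fermionTorusGraph 2 L ⊓ (⊤ : SimpleGraph (Fin 2 → ℕ)).comap (fun (x : FermionTorus 2 L) (i : Fin 2) => (ofLex x i : ℕ) / 2)) a 0).minEnergyOn (szSector (L ^ 2 - 2) 0) + (hamiltonian (fermionTorusGraph 2 L \ (⊤ : SimpleGraph (Fin 2 → ℕ)).comap (fun (x : FermionTorus 2 L) (i : Fin 2) => (ofLex x i : ℕ) / 2)) b U + hamiltonian (fermionTorusGraph 2 L ⊓ (⊤ : SimpleGraph (Fin 2 → ℕ)).comap (fun (x : FermionTorus 2 L) (i : Fin 2) => (ofLex x i : ℕ) / 2)) a 0).minEnergyOn (szSector (L ^ 2) 0) + ε ≤ 2 * (hamiltonian (fermionTorusGraph 2 L \ (⊤ : SimpleGraph (Fin 2 → ℕ)).comap (fun (x : FermionTorus 2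 L) (i : Fin 2) => (ofLex x i : ℕ) / 2)) b U + hamiltonian (fermionTorusGraph 2 L ⊓ (⊤ : SimpleGraph (Fin 2 → ℕ)).comap (fun (x : FermionTorus 2 L) (i : Fin 2) => (ofLex x i : ℕ) / 2)) a 0).minEnergyOn (szSector (L ^ 2 - 1) (1 / 2)) ∧ (∀ φ₁ φ₂, IsGroundStateInSector (hamiltonian (fermionTorusGraph 2 L \ (⊤ : SimpleGraph (Fin 2 → ℕ)).comap (fun (x : FermionTorus 2 L) (i : Fin 2) => (ofLex x i : ℕ) / 2)) b U + hamiltonian (fermionTorusGraph 2 L ⊓ (⊤ : SimpleGraph (Fin 2 → ℕ)).comap (fun (x : FermionTorus 2 L) (i : Fin 2) => (ofLex x i : ℕ) / 2)) a 0) (L ^ 2 - 2) 0 φ₁ → IsGroundStateInSector (hamiltonian (fermionTorusGraph 2 L \ (⊤ : SimpleGraph (Fin 2 → ℕ)).comap (fun (x : FermionTorus 2 L) (i : Fin 2) => (ofLex x i : ℕ) / 2)) b U + hamiltonian (fermionTorusGraph 2 L ⊓ (⊤ : SimpleGraph (Fin 2 → ℕ)).comap (fun (x : FermionTorus 2 L)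 (i : Fin 2) => (ofLex x i : ℕ) / 2)) a 0) (L ^ 2 - 2) 0 φ₂ → ∃ c : ℂ, φ₂ = c • φ₁) ∧ (∀ φ₀ φ₂, IsGroundStateInSector (hamiltonian (fermionTorusGraph 2 L \ (⊤ : SimpleGraph (Fin 2 → ℕ)).comap (fun (x : FermionTorus 2 L) (i : Fin 2) => (ofLex x i : ℕ) / 2)) b U + hamiltonian (fermionTorusGraph 2 L ⊓ (⊤ : SimpleGraph (Fin 2 → ℕ)).comap (fun (x : FermionTorus 2 L) (i : Fin 2) => (ofLex x i : ℕ) / 2)) a 0) (L ^ 2) 0 φ₀ → IsGroundStateInSector (hamiltonian (fermionTorusGraph 2 L \ (⊤ : SimpleGraph (Fin 2 → ℕ)).comap (fun (x : FermionTorus 2 L) (i : Fin 2) => (ofLex x i : ℕ) / 2)) b U + hamiltonian (fermionTorusGraph 2 L ⊓ (⊤ : SimpleGraph (Fin 2 → ℕ)).comap (fun (x : FermionTorus 2 L) (i : Fin 2) => (ofLex x i : ℕ) / 2)) a 0) (L ^ 2 - 2) 0 φ₂ → z * (L : ℝ) ^ 2 * (star φ₀ ⬝ᵥ φ₀).re *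 (star φ₂ ⬝ᵥ φ₂).re ≤ ‖star φ₂ ⬝ᵥ (pairField dWaveFormFactor L *ᵥ φ₀)‖ ^ 2)) := by
  intro L _ hL h4 a b U ε z
  obtain ⟨W, hW, hH, hN, hS, hΔ⟩ := breathingSelfDual_of_four_le L a b U hL h4
  beta_reduce at hH
  rw [← hH]
  exact (cooperPackage_unitary_conj_iff hW hN hS hΔ ε z).symm

end Swap

/-! ### Positive rescaling -/

section Scaling

/-- **Sector energies scale**: `minEnergyOn (c • A) K = c · minEnergyOn A K` for real `c ≥ 0`
(the Rayleigh set is dilated by `c`; `Real.sInf_smul_of_nonneg`). Tasaki (2020) §2.2. [folklore] -/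
theorem minEnergyOn_real_smul {n : Type*} [Fintype n] [DecidableEq n] (A : Matrix n n ℂ)
    (K : Submodule ℂ (n → ℂ)) {c : ℝ} (hc : 0 ≤ c) :
    ((c : ℂ) • A).minEnergyOn K = c * A.minEnergyOn K := by
  unfold Matrix.minEnergyOn
  have hre : ∀ ψ : n → ℂ, (star ψ ⬝ᵥ ((c : ℂ) • A) *ᵥ ψ).re = c * (star ψ ⬝ᵥ A *ᵥ ψ).re := fun ψ => by
    rw [smul_mulVec, dotProduct_smul, smul_eq_mul, Complex.re_ofReal_mul]
  have hset : {E : ℝ | ∃ ψ ∈ K, star ψ ⬝ᵥ ψ = 1 ∧ E = (star ψ ⬝ᵥ ((c : ℂ) • A) *ᵥ ψ).re} =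
      c • {E : ℝ | ∃ ψ ∈ K, star ψ ⬝ᵥ ψ = 1 ∧ E = (star ψ ⬝ᵥ A *ᵥ ψ).re} := by
    ext E
    simp only [Set.mem_smul_set, Set.mem_setOf_eq, smul_eq_mul]
    constructor
    · rintro ⟨ψ, hψ, h1, rfl⟩
      exact ⟨_, ⟨ψ, hψ, h1, rfl⟩, (hre ψ).symm⟩
    · rintro ⟨E', ⟨ψ, hψ, h1, rfl⟩, rfl⟩
      exact ⟨ψ, hψ, h1, (hre ψ).symm⟩
  rw [hset, Real.sInf_smul_of_nonneg hc, smul_eq_mul]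

/-- **Sector ground states are unchanged by positive rescaling of `H`.** [folklore] -/
theorem isGroundStateInSector_real_smul_iff {Λ : Type*} [LinearOrder Λ] [Fintype Λ]
    (H : Matrix (Finset (Orb Λ)) (Finset (Orb Λ)) ℂ) (N : ℕ) (M : ℝ) (ψ : Fock (Orb Λ)) {c : ℝ}
    (hc : 0 < c) : IsGroundStateInSector ((c : ℂ) • H) N M ψ ↔ IsGroundStateInSector H N M ψ := by
  unfold IsGroundStateInSector
  rw [minEnergyOn_real_smul H _ hc.le, smul_mulVec, Complex.ofReal_mul, mul_smul]
  have hc0 : (c : ℂ) ≠ 0 := Complex.ofReal_ne_zero.2 hc.ne'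
  refine and_congr Iff.rfl (and_congr Iff.rfl ⟨fun h => smul_right_injective _ hc0 h, fun h => by rw [h]⟩)

variable {L : ℕ} [NeZero L]

/-- **The package under positive rescaling**: `CP L (c • H) (c ε) z ↔ CP L H ε z` for `c > 0`
(energies scale, ground states and the amplitude clause do not). [folklore] -/
theorem cooperPackage_smul_iff
    (H : Matrix (Finset (Orb (FermionTorus 2 L))) (Finset (Orb (FermionTorus 2 L))) ℂ) {c : ℝ}
    (hc : 0 < c) (ε z : ℝ) :
    (((c : ℂ) • H).minEnergyOn (szSector (L ^ 2 - 2) 0) + ((c : ℂ) • H).minEnergyOn (szSector (L ^ 2) 0) + c * ε ≤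
          2 * ((c : ℂ) • H).minEnergyOn (szSector (L ^ 2 - 1) (1 / 2)) ∧
        (∀ φ₁ φ₂, IsGroundStateInSector ((c : ℂ) • H) (L ^ 2 - 2) 0 φ₁ →
          IsGroundStateInSector ((c : ℂ) • H) (L ^ 2 - 2) 0 φ₂ → ∃ c : ℂ, φ₂ = c • φ₁) ∧
        (∀ φ₀ φ₂, IsGroundStateInSector ((c : ℂ) • H) (L ^ 2) 0 φ₀ →
          IsGroundStateInSector ((c : ℂ) • H) (L ^ 2 - 2) 0 φ₂ →
            z * (L : ℝ) ^ 2 * (star φ₀ ⬝ᵥ φ₀).re * (star φ₂ ⬝ᵥ φ₂).re ≤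
              ‖star φ₂ ⬝ᵥ (pairField dWaveFormFactor L *ᵥ φ₀)‖ ^ 2)) ↔
    (H.minEnergyOn (szSector (L ^ 2 - 2) 0) + H.minEnergyOn (szSector (L ^ 2) 0) + ε ≤
          2 * H.minEnergyOn (szSector (L ^ 2 - 1) (1 / 2)) ∧
        (∀ φ₁ φ₂, IsGroundStateInSector H (L ^ 2 - 2) 0 φ₁ →
          IsGroundStateInSector H (L ^ 2 - 2) 0 φ₂ → ∃ c : ℂ, φ₂ = c • φ₁) ∧
        (∀ φ₀ φ₂, IsGroundStateInSector H (L ^ 2) 0 φ₀ →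
          IsGroundStateInSector H (L ^ 2 - 2) 0 φ₂ →
            z * (L : ℝ) ^ 2 * (star φ₀ ⬝ᵥ φ₀).re * (star φ₂ ⬝ᵥ φ₂).re ≤
              ‖star φ₂ ⬝ᵥ (pairField dWaveFormFactor L *ᵥ φ₀)‖ ^ 2)) := by
  simp only [minEnergyOn_real_smul H _ hc.le, isGroundStateInSector_real_smul_iff H _ _ _ hc]
  refine and_congr ⟨fun h => ?_, fun h => ?_⟩ Iff.rfl
  · nlinarith
  · nlinarith

omit [NeZero L] in
/-- **The breathing family is homogeneous**: `H_L(a,b,U) = a · H_L(1, b/a, U/a)` for `a ≠ 0`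
(`hamiltonian G t U` is linear in `(t, U)`). [folklore] -/
theorem breathing_scale {a : ℝ} (ha : a ≠ 0) (b U : ℝ) :
    (hamiltonian (fermionTorusGraph 2 L \ (⊤ : SimpleGraph (Fin 2 → ℕ)).comap (fun (x : FermionTorus 2 L) (i : Fin 2) => (ofLex x i : ℕ) / 2)) a U + hamiltonian (fermionTorusGraph 2 L ⊓ (⊤ : SimpleGraph (Fin 2 → ℕ)).comap (fun (x : FermionTorus 2 L) (i : Fin 2) => (ofLex x i : ℕ) / 2)) b 0) =
      (a : ℂ) • (hamiltonian (fermionTorusGraph 2 L \ (⊤ : SimpleGraph (Fin 2 → ℕ)).comap (fun (x : FermionTorus 2 L) (i : Fin 2) => (ofLex x i : ℕ) / 2)) 1 (U / a) + hamiltonian (fermionTorusGraph 2 L ⊓ (⊤ : SimpleGraph (Fin 2 → ℕ)).comap (fun (x : FermionTorus 2 L) (i : Fin 2) => (ofLex x i : ℕ) / 2)) (b / a) 0) := by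
  simp only [hamiltonian, smul_add, smul_smul, Complex.ofReal_zero, zero_smul, add_zero]
  have h1 : (a : ℂ) * -((1 : ℝ) : ℂ) = -(a : ℂ) := by push_cast; ring
  have h2 : (a : ℂ) * ((U / a : ℝ) : ℂ) = (U : ℂ) := by
    push_cast; field_simp
  have h3 : (a : ℂ) * -((b / a : ℝ) : ℂ) = -(b : ℂ) := by
    push_cast; field_simp
  rw [h1, h2, h3]

/-- **The corner transports to the opposite corner.** If the package holds for `H_L(1, b, U₀)`
with data `(ε, z)` (`b > 0`, `L ≥ 4` even), then it holds for `H_L(1, 1/b, U₀/b)` — inter-plaquette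
hopping `1/b`, repulsion `U₀/b` — with data `(ε/b, z)`: swap `a ↔ b` by self-duality, then divide
by `b`. This is the only motion along the breathing family supplied by its symmetry; it never
reaches the self-dual point `(1, 1)` unless `b = 1`. [cite: YaoTsaiKivelson2007] -/
theorem corner_transport (hL : Even L) (h4 : 4 ≤ L) {b : ℝ} (hb : 0 < b) (U₀ ε z : ℝ)
    (h : (hamiltonian (fermionTorusGraph 2 L \ (⊤ : SimpleGraph (Fin 2 → ℕ)).comap (fun (x : FermionTorus 2 L) (i : Fin 2) => (ofLex x i : ℕ) / 2)) 1 U₀ + hamiltonian (fermionTorusGraph 2 L ⊓ (⊤ : SimpleGraph (Fin 2 → ℕ)).comap (fun (x : FermionTorus 2 L) (i : Fin 2) => (ofLex x i : ℕ) / 2)) b 0).minEnergyOn (szSector (L ^ 2 - 2) 0) + (hamiltonian (fermionTorusGraph 2 L \ (⊤ : SimpleGraph (Fin 2 → ℕ)).comap (fun (x : FermionTorus 2 L) (i : Fin 2) => (ofLex x i : ℕ) / 2)) 1 U₀ + hamiltonian (fermionTorusGraph 2 L ⊓ (⊤ : SimpleGraph (Fin 2 → ℕ)).comap (fun (x : FermionTorus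 2 L) (i : Fin 2) => (ofLex x i : ℕ) / 2)) b 0).minEnergyOn (szSector (L ^ 2) 0) + ε ≤
          2 * (hamiltonian (fermionTorusGraph 2 L \ (⊤ : SimpleGraph (Fin 2 → ℕ)).comap (fun (x : FermionTorus 2 L) (i : Fin 2) => (ofLex x i : ℕ) / 2)) 1 U₀ + hamiltonian (fermionTorusGraph 2 L ⊓ (⊤ : SimpleGraph (Fin 2 → ℕ)).comap (fun (x : FermionTorus 2 L) (i : Fin 2) => (ofLex x i : ℕ) / 2)) b 0).minEnergyOn (szSector (L ^ 2 - 1) (1 / 2)) ∧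
        (∀ φ₁ φ₂, IsGroundStateInSector (hamiltonian (fermionTorusGraph 2 L \ (⊤ : SimpleGraph (Fin 2 → ℕ)).comap (fun (x : FermionTorus 2 L) (i : Fin 2) => (ofLex x i : ℕ) / 2)) 1 U₀ + hamiltonian (fermionTorusGraph 2 L ⊓ (⊤ : SimpleGraph (Fin 2 → ℕ)).comap (fun (x : FermionTorus 2 L) (i : Fin 2) => (ofLex x i : ℕ) / 2)) b 0) (L ^ 2 - 2) 0 φ₁ →
          IsGroundStateInSector (hamiltonian (fermionTorusGraph 2 L \ (⊤ : SimpleGraph (Fin 2 → ℕ)).comap (fun (x : FermionTorus 2 L) (i : Fin 2) => (ofLex x i : ℕ) / 2)) 1 U₀ + hamiltonian (fermionTorusGraph 2 L ⊓ (⊤ : SimpleGraph (Fin 2 → ℕ)).comap (fun (x : FermionTorus 2 L) (i : Fin 2) => (ofLex x i : ℕ) / 2)) b 0) (L ^ 2 - 2) 0 φ₂ → ∃ c : ℂ, φ₂ = c • φ₁) ∧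
        (∀ φ₀ φ₂, IsGroundStateInSector (hamiltonian (fermionTorusGraph 2 L \ (⊤ : SimpleGraph (Fin 2 → ℕ)).comap (fun (x : FermionTorus 2 L) (i : Fin 2) => (ofLex x i : ℕ) / 2)) 1 U₀ + hamiltonian (fermionTorusGraph 2 L ⊓ (⊤ : SimpleGraph (Fin 2 → ℕ)).comap (fun (x : FermionTorus 2 L) (i : Fin 2) => (ofLex x i : ℕ) / 2)) b 0) (L ^ 2) 0 φ₀ →
          IsGroundStateInSector (hamiltonian (fermionTorusGraph 2 L \ (⊤ : SimpleGraph (Fin 2 → ℕ)).comap (fun (x : FermionTorus 2 L) (i : Fin 2) => (ofLex x i : ℕ) / 2)) 1 U₀ + hamiltonian (fermionTorusGraph 2 L ⊓ (⊤ : SimpleGraph (Fin 2 → ℕ)).comap (fun (x : FermionTorus 2 L) (i : Fin 2) => (ofLex x i : ℕ) / 2)) b 0) (L ^ 2 - 2) 0 φ₂ →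
            z * (L : ℝ) ^ 2 * (star φ₀ ⬝ᵥ φ₀).re * (star φ₂ ⬝ᵥ φ₂).re ≤
              ‖star φ₂ ⬝ᵥ (pairField dWaveFormFactor L *ᵥ φ₀)‖ ^ 2)) :
    (hamiltonian (fermionTorusGraph 2 L \ (⊤ : SimpleGraph (Fin 2 → ℕ)).comap (fun (x : FermionTorus 2 L) (i : Fin 2) => (ofLex x i : ℕ) / 2)) 1 (U₀ / b) + hamiltonian (fermionTorusGraph 2 L ⊓ (⊤ : SimpleGraph (Fin 2 → ℕ)).comap (fun (x : FermionTorus 2 L) (i : Fin 2) => (ofLex x i : ℕ) / 2)) (1 / b) 0).minEnergyOn (szSector (L ^ 2 - 2) 0) + (hamiltonian (fermionTorusGraph 2 L \ (⊤ : SimpleGraph (Fin 2 → ℕ)).comap (fun (x : FermionTorus 2 L) (i : Fin 2) => (ofLex x i : ℕ) / 2)) 1 (U₀ / b) + hamiltonian (fermionTorusGraph 2 L ⊓ (⊤ : SimpleGraph (Fin 2 → ℕ)).comap (fun (x : FermionTorus 2 L) (i : Fin 2) => (ofLex x i : ℕ) / 2)) (1 / b) 0).minEnergyOn (szSector (L ^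 2) 0) + (ε / b) ≤
          2 * (hamiltonian (fermionTorusGraph 2 L \ (⊤ : SimpleGraph (Fin 2 → ℕ)).comap (fun (x : FermionTorus 2 L) (i : Fin 2) => (ofLex x i : ℕ) / 2)) 1 (U₀ / b) + hamiltonian (fermionTorusGraph 2 L ⊓ (⊤ : SimpleGraph (Fin 2 → ℕ)).comap (fun (x : FermionTorus 2 L) (i : Fin 2) => (ofLex x i : ℕ) / 2)) (1 / b) 0).minEnergyOn (szSector (L ^ 2 - 1) (1 / 2)) ∧
        (∀ φ₁ φ₂, IsGroundStateInSector (hamiltonian (fermionTorusGraph 2 L \ (⊤ : SimpleGraph (Fin 2 → ℕ)).comap (fun (x : FermionTorus 2 L) (i : Fin 2) => (ofLex x i : ℕ) / 2)) 1 (U₀ / b) + hamiltonian (fermionTorusGraph 2 L ⊓ (⊤ : SimpleGraph (Fin 2 → ℕ)).comap (fun (x : FermionTorus 2 L) (i : Fin 2) => (ofLex x i : ℕ) / 2)) (1 / b) 0) (L ^ 2 - 2) 0 φ₁ →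
          IsGroundStateInSector (hamiltonian (fermionTorusGraph 2 L \ (⊤ : SimpleGraph (Fin 2 → ℕ)).comap (fun (x : FermionTorus 2 L) (i : Fin 2) => (ofLex x i : ℕ) / 2)) 1 (U₀ / b) + hamiltonian (fermionTorusGraph 2 L ⊓ (⊤ : SimpleGraph (Fin 2 → ℕ)).comap (fun (x : FermionTorus 2 L) (i : Fin 2) => (ofLex x i : ℕ) / 2)) (1 / b) 0) (L ^ 2 - 2) 0 φ₂ → ∃ c : ℂ, φ₂ = c • φ₁) ∧
        (∀ φ₀ φ₂, IsGroundStateInSector (hamiltonian (fermionTorusGraph 2 L \ (⊤ : SimpleGraph (Fin 2 → ℕ)).comap (fun (x : FermionTorus 2 L) (i : Fin 2) => (ofLex x i : ℕ) / 2)) 1 (U₀ / b) + hamiltonian (fermionTorusGraph 2 L ⊓ (⊤ : SimpleGraph (Fin 2 → ℕ)).comap (fun (x : FermionTorus 2 L) (i : Fin 2) => (ofLex x i : ℕ) / 2)) (1 / b) 0) (L ^ 2) 0 φ₀ →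
          IsGroundStateInSector (hamiltonian (fermionTorusGraph 2 L \ (⊤ : SimpleGraph (Fin 2 → ℕ)).comap (fun (x : FermionTorus 2 L) (i : Fin 2) => (ofLex x i : ℕ) / 2)) 1 (U₀ / b) + hamiltonian (fermionTorusGraph 2 L ⊓ (⊤ : SimpleGraph (Fin 2 → ℕ)).comap (fun (x : FermionTorus 2 L) (i : Fin 2) => (ofLex x i : ℕ) / 2)) (1 / b) 0) (L ^ 2 - 2) 0 φ₂ →
            z * (L : ℝ) ^ 2 * (star φ₀ ⬝ᵥ φ₀).re * (star φ₂ ⬝ᵥ φ₂).re ≤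
              ‖star φ₂ ⬝ᵥ (pairField dWaveFormFactor L *ᵥ φ₀)‖ ^ 2) := by
  have hswap := (cooperPackage_breathing_swap hL h4 1 b U₀ ε z).1 h
  rw [breathing_scale hb.ne' 1 U₀] at hswap
  have hε : ε = b * (ε / b) := by field_simp
  rw [hε] at hswap
  exact (cooperPackage_smul_iff _ hb (ε / b) z).1 hswap

/-- **The crux's corner hypothesis, transported** (sides `L = 4k + 4`): if for some
`U₀ ∈ [2, 4]` and all `b ∈ (0, b₀)` the package of `H_L(1, b, U₀)` holds eventually in `k`, then
for the same `U₀`, `b₀` and all `b ∈ (0, b₀)` the package of the opposite-corner Hamiltonian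
`H_L(1, 1/b, U₀/b)` holds eventually in `k` (margin `ε/b`). Written against the crux's
hypothesis verbatim; records what the self-duality does and does not give toward `BindingWalk`.
[cite: YaoTsaiKivelson2007] -/
theorem corner_hypothesis_transport :
    (∃ U₀ ∈ Set.Icc (2 : ℝ) 4, ∃ b₀ > (0 : ℝ), ∀ b ∈ Set.Ioo 0 b₀, ∃ ε > (0 : ℝ), ∃ z > (0 : ℝ), ∃ k₀ : ℕ, ∀ k ≥ k₀, (hamiltonian (fermionTorusGraph 2 (4 * k + 4) \ (⊤ : SimpleGraph (Fin 2 → ℕ)).comap (fun (x : FermionTorus 2 (4 * k + 4)) (i : Fin 2) => (ofLex x i : ℕ) / 2)) 1 U₀ + hamiltonian (fermionTorusGraph 2 (4 * k + 4) ⊓ (⊤ : SimpleGraph (Fin 2 → ℕ)).comap (fun (x : FermionTorus 2 (4 * k + 4)) (i : Fin 2) => (ofLex x i : ℕ) / 2)) b 0).minEnergyOn (szSector ((4 * k + 4) ^ 2 - 2) 0) + (hamiltonian (fermionTorusGraph 2 (4 * k + 4) \ (⊤ : SimpleGraph (Fin 2 → ℕ)).comap (fun (x : FermionTorus 2 (4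 * k + 4)) (i : Fin 2) => (ofLex x i : ℕ) / 2)) 1 U₀ + hamiltonian (fermionTorusGraph 2 (4 * k + 4) ⊓ (⊤ : SimpleGraph (Fin 2 → ℕ)).comap (fun (x : FermionTorus 2 (4 * k + 4)) (i : Fin 2) => (ofLex x i : ℕ) / 2)) b 0).minEnergyOn (szSector ((4 * k + 4) ^ 2) 0) + ε ≤ 2 * (hamiltonian (fermionTorusGraph 2 (4 * k + 4) \ (⊤ : SimpleGraph (Fin 2 → ℕ)).comap (fun (x : FermionTorus 2 (4 * k + 4)) (i : Fin 2) => (ofLex x i : ℕ) / 2)) 1 U₀ + hamiltonian (fermionTorusGraph 2 (4 * k + 4) ⊓ (⊤ : SimpleGraph (Fin 2 → ℕ)).comap (fun (x : FermionTorus 2 (4 * k + 4)) (i : Fin 2) => (ofLex x i : ℕ) / 2)) b 0).minEnergyOn (szSector ((4 * k + 4) ^ 2 - 1) (1 / 2)) ∧ (∀ φ₁ φ₂, IsGroundStateInSector (hamiltonian (fermionTorusGraph 2 (4 * k + 4) \ (⊤ : SimpleGraph (Fin 2 → ℕ)).comap (fun (x : FermionTorus 2 (4 * k + 4)) (i : Fin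 2) => (ofLex x i : ℕ) / 2)) 1 U₀ + hamiltonian (fermionTorusGraph 2 (4 * k + 4) ⊓ (⊤ : SimpleGraph (Fin 2 → ℕ)).comap (fun (x : FermionTorus 2 (4 * k + 4)) (i : Fin 2) => (ofLex x i : ℕ) / 2)) b 0) ((4 * k + 4) ^ 2 - 2) 0 φ₁ → IsGroundStateInSector (hamiltonian (fermionTorusGraph 2 (4 * k + 4) \ (⊤ : SimpleGraph (Fin 2 → ℕ)).comap (fun (x : FermionTorus 2 (4 * k + 4)) (i : Fin 2) => (ofLex x i : ℕ) / 2)) 1 U₀ + hamiltonian (fermionTorusGraph 2 (4 * k + 4) ⊓ (⊤ : SimpleGraph (Fin 2 → ℕ)).comap (fun (x : FermionTorus 2 (4 * k + 4)) (i : Fin 2) => (ofLex x i : ℕ) / 2)) b 0) ((4 * k + 4) ^ 2 - 2) 0 φ₂ → ∃ c : ℂ, φ₂ = c • φ₁) ∧ (∀ φ₀ φ₂, IsGroundStateInSector (hamiltonian (fermionTorusGraph 2 (4 * k + 4) \ (⊤ : SimpleGraph (Fin 2 → ℕ)).comap (fun (x : FermionTorus 2 (4 * k + 4)) (i : Fin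 2) => (ofLex x i : ℕ) / 2)) 1 U₀ + hamiltonian (fermionTorusGraph 2 (4 * k + 4) ⊓ (⊤ : SimpleGraph (Fin 2 → ℕ)).comap (fun (x : FermionTorus 2 (4 * k + 4)) (i : Fin 2) => (ofLex x i : ℕ) / 2)) b 0) ((4 * k + 4) ^ 2) 0 φ₀ → IsGroundStateInSector (hamiltonian (fermionTorusGraph 2 (4 * k + 4) \ (⊤ : SimpleGraph (Fin 2 → ℕ)).comap (fun (x : FermionTorus 2 (4 * k + 4)) (i : Fin 2) => (ofLex x i : ℕ) / 2)) 1 U₀ + hamiltonian (fermionTorusGraph 2 (4 * k + 4) ⊓ (⊤ : SimpleGraph (Fin 2 → ℕ)).comap (fun (x : FermionTorus 2 (4 * k + 4)) (i : Fin 2) => (ofLex x i : ℕ) / 2)) b 0) ((4 * k + 4) ^ 2 - 2) 0 φ₂ → z * ((4 * k + 4 : ℕ) : ℝ) ^ 2 * (star φ₀ ⬝ᵥ φ₀).re * (star φ₂ ⬝ᵥ φ₂).re ≤ ‖star φ₂ ⬝ᵥ (pairField dWaveFormFactor (4 * k + 4) *ᵥ φ₀)‖ ^ 2)) → ∃ U₀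 ∈ Set.Icc (2 : ℝ) 4, ∃ b₀ > (0 : ℝ), ∀ b ∈ Set.Ioo 0 b₀, ∃ ε > (0 : ℝ), ∃ z > (0 : ℝ), ∃ k₀ : ℕ, ∀ k ≥ k₀, (hamiltonian (fermionTorusGraph 2 (4 * k + 4) \ (⊤ : SimpleGraph (Fin 2 → ℕ)).comap (fun (x : FermionTorus 2 (4 * k + 4)) (i : Fin 2) => (ofLex x i : ℕ) / 2)) 1 (U₀ / b) + hamiltonian (fermionTorusGraph 2 (4 * k + 4) ⊓ (⊤ : SimpleGraph (Fin 2 → ℕ)).comap (fun (x : FermionTorus 2 (4 * k + 4)) (i : Fin 2) => (ofLex x i : ℕ) / 2)) (1 / b) 0).minEnergyOn (szSector ((4 * k + 4) ^ 2 - 2) 0) + (hamiltonian (fermionTorusGraph 2 (4 * k + 4) \ (⊤ : SimpleGraph (Fin 2 → ℕ)).comap (fun (x : FermionTorus 2 (4 * k + 4)) (i : Fin 2) => (ofLex x i : ℕ) / 2)) 1 (U₀ / b) + hamiltonian (fermionTorusGraph 2 (4 * k + 4) ⊓ (⊤ : SimpleGraph (Fin 2 → ℕ)).comap (fun (x : FermionTorus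 2 (4 * k + 4)) (i : Fin 2) => (ofLex x i : ℕ) / 2)) (1 / b) 0).minEnergyOn (szSector ((4 * k + 4) ^ 2) 0) + ε ≤ 2 * (hamiltonian (fermionTorusGraph 2 (4 * k + 4) \ (⊤ : SimpleGraph (Fin 2 → ℕ)).comap (fun (x : FermionTorus 2 (4 * k + 4)) (i : Fin 2) => (ofLex x i : ℕ) / 2)) 1 (U₀ / b) + hamiltonian (fermionTorusGraph 2 (4 * k + 4) ⊓ (⊤ : SimpleGraph (Fin 2 → ℕ)).comap (fun (x : FermionTorus 2 (4 * k + 4)) (i : Fin 2) => (ofLex x i : ℕ) / 2)) (1 / b) 0).minEnergyOn (szSector ((4 * k + 4) ^ 2 - 1) (1 / 2)) ∧ (∀ φ₁ φ₂, IsGroundStateInSector (hamiltonian (fermionTorusGraph 2 (4 * k + 4) \ (⊤ : SimpleGraph (Fin 2 → ℕ)).comap (fun (x : FermionTorus 2 (4 * k + 4)) (i : Fin 2) => (ofLex x i : ℕ) / 2)) 1 (U₀ / b) + hamiltonian (fermionTorusGraph 2 (4 * k + 4) ⊓ (⊤ : SimpleGraph (Fin 2 → ℕ)).comap (fun (x :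 FermionTorus 2 (4 * k + 4)) (i : Fin 2) => (ofLex x i : ℕ) / 2)) (1 / b) 0) ((4 * k + 4) ^ 2 - 2) 0 φ₁ → IsGroundStateInSector (hamiltonian (fermionTorusGraph 2 (4 * k + 4) \ (⊤ : SimpleGraph (Fin 2 → ℕ)).comap (fun (x : FermionTorus 2 (4 * k + 4)) (i : Fin 2) => (ofLex x i : ℕ) / 2)) 1 (U₀ / b) + hamiltonian (fermionTorusGraph 2 (4 * k + 4) ⊓ (⊤ : SimpleGraph (Fin 2 → ℕ)).comap (fun (x : FermionTorus 2 (4 * k + 4)) (i : Fin 2) => (ofLex x i : ℕ) / 2)) (1 / b) 0) ((4 * k + 4) ^ 2 - 2) 0 φ₂ → ∃ c : ℂ, φ₂ = c • φ₁) ∧ (∀ φ₀ φ₂, IsGroundStateInSector (hamiltonian (fermionTorusGraph 2 (4 * k + 4) \ (⊤ : SimpleGraph (Fin 2 → ℕ)).comap (fun (x : FermionTorus 2 (4 * k + 4)) (i : Fin 2) => (ofLex x i : ℕ) / 2)) 1 (U₀ / b) + hamiltonian (fermionTorusGraph 2 (4 * k + 4) ⊓ (⊤ : SimpleGraph (Fin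 2 → ℕ)).comap (fun (x : FermionTorus 2 (4 * k + 4)) (i : Fin 2) => (ofLex x i : ℕ) / 2)) (1 / b) 0) ((4 * k + 4) ^ 2) 0 φ₀ → IsGroundStateInSector (hamiltonian (fermionTorusGraph 2 (4 * k + 4) \ (⊤ : SimpleGraph (Fin 2 → ℕ)).comap (fun (x : FermionTorus 2 (4 * k + 4)) (i : Fin 2) => (ofLex x i : ℕ) / 2)) 1 (U₀ / b) + hamiltonian (fermionTorusGraph 2 (4 * k + 4) ⊓ (⊤ : SimpleGraph (Fin 2 → ℕ)).comap (fun (x : FermionTorus 2 (4 * k + 4)) (i : Fin 2) => (ofLex x i : ℕ) / 2)) (1 / b) 0) ((4 * k + 4) ^ 2 - 2) 0 φ₂ → z * ((4 * k + 4 : ℕ) : ℝ) ^ 2 * (star φ₀ ⬝ᵥ φ₀).re * (star φ₂ ⬝ᵥ φ₂).re ≤ ‖star φ₂ ⬝ᵥ (pairField dWaveFormFactor (4 * k + 4) *ᵥ φ₀)‖ ^ 2) := by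
  intro hC
  obtain ⟨U₀, hU₀, b₀, hb₀, hb⟩ := hC
  refine ⟨U₀, hU₀, b₀, hb₀, fun b hbI => ?_⟩
  obtain ⟨ε, hε, z, hz, k₀, hk⟩ := hb b hbI
  refine ⟨ε / b, div_pos hε hbI.1, z, hz, k₀, fun k hk' => ?_⟩
  exact corner_transport (L := 4 * k + 4) ⟨2 * k + 2, by ring⟩ (by omega) hbI.1 U₀ ε z (hk k hk')

end Scaling

end Summit.HubbardSuperconductivity.HubbardSuperconductivity.Theorems.CooperPairDMottWalk

end
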